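import Summits.Ventures.LatticeQCDFlow.Exactness.IMHColdStartPathMixture
import HarnessLib

/-!
# The thaw decomposition: from a mode, the flow-MCMC run is a geometric mixture of frozen prefixes glued to
# equilibrium runs

HONEST FRAMING: exact (Metropolis-corrected) sampling algorithms for lattice gauge theory;
figures of merit are autocorrelation/cost numbers at stated couplings and volumes; no
continuum-physics claim.

Venture `LatticeQCDFlow` (cell pub-lqcd), topic `Exactness`; FANOUT row 30 (lean-1, GEN-33).  NEW WORK of the
cell, general state space.  `K = indepMH q w` (proposal `q`, normalised weight `w = dπ/dq`, `π = w·q`), `x₀` a mode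
of `w`, `A = 1/w(x₀)`, `r = 1 − A`; `P_μ` = Mathlib's `Kernel.trajMeasure` of the chain from `μ`.  GEN-31 proved the
one-step renewal `K(x₀,·) = A·π + r·δ_{x₀}`; the previous file (`IMHColdStartPathMixture`) lifted the one-time law to
the law of the shifted stream.  Here the law of the WHOLE cold-started run `P_{x₀}` is decomposed.  Write
`pad_t y := (x₀, …, x₀, y_0, y_1, …)` (`t` frozen copies of the cold configuration, then `y`; inline below as
`fun y n => if n < t then x₀ else y (n − t)`, no definition is introduced):

* §1 bookkeeping: `pad_t` is measurable, `pad_0 = id`, `pad_s ∘ pad_t = pad_{s+t}`, and the cold-started path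
  is its own `pad_1`-image of its `1`-shift (`X_0 = x₀` almost surely).
* §2 **`imh_chain_thaw_step`** — ONE THAW STEP: `P_{x₀} = A·(pad_1)_* P_π + r·(pad_1)_* P_{x₀}` — after the
  forced first configuration the run is, with probability `A`, an equilibrium run and, with probability `r`, a
  fresh cold-started run (the path-level form of GEN-31's renewal).
* §3 **`imh_chain_thaw_depth`** — THE THAW DECOMPOSITION TO DEPTH `n`:
  `P_{x₀} = Σ_{t<n} A r^t·(pad_{t+1})_* P_π + r^n·(pad_n)_* P_{x₀}` EXACTLY, for every `n`; integral form
  **`imh_chain_thaw_integral`** for every bounded measurable path statistic, and for a statistic of the first `n`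
  configurations only (**`imh_chain_thaw_integral_of_dependsOn`**):
  `E_{x₀}[F] = Σ_{t<n} A r^t·E_π[F ∘ pad_{t+1}] + r^n·F(x₀, x₀, …)` — THE EXACT LAW OF THE FIRST `n` CONFIGURATIONS
  OF A COLD-STARTED EXACT SAMPLER: `t + 1` frozen copies of the cold configuration (probability `A r^t`) followed by
  an INDEPENDENT equilibrium run, or all `n` frozen (probability `r^n`); GEN-31's one-time and GEN-32's two-time laws
  are its first two shadows, and every `k`-time law follows by evaluation.
* §4 **`imh_chain_thaw_sum`** — THE FULL THAW DECOMPOSITION as an identity of measures on path space: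
  `P_{x₀} = Σ_{t≥0} A r^t·(pad_{t+1})_* P_π` (Mathlib `Measure.sum`; the remainder `r^n·(pad_n)_*P_{x₀}` has mass
  `r^n → 0` because `A > 0`); integral form **`imh_chain_thaw_hasSum`**: `E_{x₀}[F] = Σ_{t≥0} A r^t·E_π[F ∘ pad_{t+1}]`
  for every bounded measurable `F`.

Reading (gauge files `Scaling/AutoregressiveGauge…Thaw`): a cold-started exact gauge sampler (`A = Z/(c^{#B}M^k)` resp.
`Z/∏_ℓ c_{#C_ℓ}`) produces, in law, `T` copies of the cold configuration with `P(T = t + 1) = A(1 − A)^t` and then an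
equilibrium run independent of `T`; every statistic of the run is the corresponding geometric mixture of equilibrium
statistics of padded runs.  NOT CLAIMED: anything from a non-modal start (no renewal at the first step); the law of
the first MOVE time for proposals with an atom at `x₀` (then the accepted configuration can be `x₀` again — the
decomposition above holds regardless, the identification `T = first move` needs `q{x₀} = 0`, next file).

No `sorry`, no new definitions, nothing cited as a fact; general measurable space with measurable singletons.
-/

noncomputable section

namespace Summit.Ventures.LatticeQCDFlow.Exactness

open MeasureTheory ProbabilityTheory Function Finset Filter
open scoped ENNReal Topology
open Summit.Ventures.LatticeQCDFlow.Scoring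

variable {Ω : Type*} [MeasurableSpace Ω]

/-! ## §1 Bookkeeping: the padding maps -/

/-- `pad_t : y ↦ (x₀,…,x₀,y_0,y_1,…)` is measurable. [ours, bookkeeping] -/
theorem measurable_pad (x₀ : Ω) (t : ℕ) :
    Measurable (fun (y : ℕ → Ω) (n : ℕ) => if n < t then x₀ else y (n - t)) := by
  refine measurable_pi_lambda _ fun n => ?_
  by_cases hn : n < t
  · simp only [hn, if_true]; exact measurable_const
  · simp only [hn, if_false]; exact measurable_pi_apply _

omit [MeasurableSpace Ω] in
/-- `pad_0 = id`. [ours, bookkeeping] -/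
theorem pad_zero (x₀ : Ω) : (fun (y : ℕ → Ω) (n : ℕ) => if n < 0 then x₀ else y (n - 0)) = id := by
  funext y n
  simp

omit [MeasurableSpace Ω] in
/-- `pad_s ∘ pad_t = pad_{s+t}`. [ours, bookkeeping] -/
theorem pad_comp_pad (x₀ : Ω) (s t : ℕ) :
    (fun (y : ℕ → Ω) (n : ℕ) => if n < s then x₀ else y (n - s)) ∘
        (fun (y : ℕ → Ω) (n : ℕ) => if n < t then x₀ else y (n - t)) =
      fun (y : ℕ → Ω) (n : ℕ) => if n < s + t then x₀ else y (n - (s + t)) := by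
  funext y n
  simp only [Function.comp_apply]
  by_cases h1 : n < s
  · rw [if_pos h1, if_pos (by omega)]
  · rw [if_neg h1]
    by_cases h2 : n - s < t
    · rw [if_pos h2, if_pos (by omega)]
    · rw [if_neg h2, if_neg (by omega), Nat.sub_sub]

/-- Pushing forward along `pad_s` after `pad_t` is pushing forward along `pad_{s+t}`. [ours, bookkeeping] -/
theorem map_pad_map_pad (x₀ : Ω) (P : Measure (ℕ → Ω)) (s t : ℕ) :
    (P.map (fun (y : ℕ → Ω) (n : ℕ) => if n < t then x₀ else y (n - t))).map
        (fun (y : ℕ → Ω) (n : ℕ) => if n < s then x₀ else y (n - s)) =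
      P.map (fun (y : ℕ → Ω) (n : ℕ) => if n < s + t then x₀ else y (n - (s + t))) := by
  rw [Measure.map_map (measurable_pad x₀ s) (measurable_pad x₀ t), pad_comp_pad]

/-- **The cold-started path is the `pad_1`-image of its own `1`-shift**: `X_0 = x₀` almost surely under `P_{x₀}`
(any Markov kernel). [ours, bookkeeping] -/
theorem chain_dirac_map_pad_shift [MeasurableSingletonClass Ω] (κ : Kernel Ω Ω) [IsMarkovKernel κ] (x₀ : Ω) :
    ((Kernel.trajMeasure (X := fun _ : ℕ => Ω) (Measure.dirac x₀)
        (fun n : ℕ => κ.comap (fun h : (i : ↥(Finset.Iic n)) → Ω => h ⟨n, Finset.mem_Iic.2 le_rfl⟩)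
          (measurable_pi_apply _))).map (fun (x : ℕ → Ω) (n : ℕ) => x (1 + n))).map
        (fun (y : ℕ → Ω) (n : ℕ) => if n < 1 then x₀ else y (n - 1)) =
      Kernel.trajMeasure (X := fun _ : ℕ => Ω) (Measure.dirac x₀)
        (fun n : ℕ => κ.comap (fun h : (i : ↥(Finset.Iic n)) → Ω => h ⟨n, Finset.mem_Iic.2 le_rfl⟩)
          (measurable_pi_apply _)) := by
  set P := Kernel.trajMeasure (X := fun _ : ℕ => Ω) (Measure.dirac x₀)
      (fun n : ℕ => κ.comap (fun h : (i : ↥(Finset.Iic n)) → Ω => h ⟨n, Finset.mem_Iic.2 le_rfl⟩)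
        (measurable_pi_apply _)) with hP
  have hΘ : Measurable (fun (x : ℕ → Ω) (n : ℕ) => x (1 + n)) :=
    measurable_pi_lambda _ fun n => measurable_pi_apply _
  rw [Measure.map_map (measurable_pad x₀ 1) hΘ]
  -- the composite is the identity on `{X_0 = x₀}`, a set of full measure
  have h0 : ∀ᵐ x ∂P, x 0 = x₀ := by
    have h1 : P.map (fun x : ℕ → Ω => x 0) = Measure.dirac x₀ := by
      rw [hP]; exact chain_map_eval_zero κ (Measure.dirac x₀)
    have h2 : ∀ᵐ z ∂(P.map (fun x : ℕ → Ω => x 0)), z ∈ ({x₀} : Set Ω) := by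
      rw [h1]; exact (ae_dirac_iff (measurableSet_singleton x₀)).2 rfl
    exact ae_of_ae_map (measurable_pi_apply 0).aemeasurable h2
  have hae : ((fun (y : ℕ → Ω) (n : ℕ) => if n < 1 then x₀ else y (n - 1)) ∘
      (fun (x : ℕ → Ω) (n : ℕ) => x (1 + n))) =ᵐ[P] id := by
    filter_upwards [h0] with x hx
    funext n
    simp only [Function.comp_apply, id]
    by_cases hn : n < 1
    · rw [if_pos hn, show n = 0 by omega, hx]
    · rw [if_neg hn]; congr 1; omega
  rw [Measure.map_congr hae, Measure.map_id]

/-! ## §2 One thaw step -/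

variable [MeasurableSingletonClass Ω] {q : Measure Ω} [IsProbabilityMeasure q] {w : Ω → ℝ}

/-- **ONE THAW STEP**: `P_{x₀} = A·(pad_1)_* P_π + r·(pad_1)_* P_{x₀}` (`A = 1/w(x₀)`, `r = 1 − A`). [ours] -/
theorem imh_chain_thaw_step [Fact (Measurable w)] (hw0 : ∀ y, 0 < w y) {x₀ : Ω} (hmax : ∀ y, w y ≤ w x₀)
    [IsProbabilityMeasure (q.withDensity fun y => ENNReal.ofReal (w y))] :
    Kernel.trajMeasure (X := fun _ : ℕ => Ω) (Measure.dirac x₀)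
        (fun n : ℕ => (indepMH q w).comap (fun h : (i : ↥(Finset.Iic n)) → Ω => h ⟨n, Finset.mem_Iic.2 le_rfl⟩)
          (measurable_pi_apply _)) =
      ENNReal.ofReal (w x₀)⁻¹ •
          (Kernel.trajMeasure (X := fun _ : ℕ => Ω) (q.withDensity fun y => ENNReal.ofReal (w y))
            (fun n : ℕ => (indepMH q w).comap (fun h : (i : ↥(Finset.Iic n)) → Ω => h ⟨n, Finset.mem_Iic.2 le_rfl⟩)
              (measurable_pi_apply _))).map (fun (y : ℕ → Ω) (n : ℕ) => if n < 1 then x₀ else y (n - 1)) +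
        ENNReal.ofReal (1 - (w x₀)⁻¹) •
          (Kernel.trajMeasure (X := fun _ : ℕ => Ω) (Measure.dirac x₀)
            (fun n : ℕ => (indepMH q w).comap (fun h : (i : ↥(Finset.Iic n)) → Ω => h ⟨n, Finset.mem_Iic.2 le_rfl⟩)
              (measurable_pi_apply _))).map (fun (y : ℕ → Ω) (n : ℕ) => if n < 1 then x₀ else y (n - 1)) := by
  conv_lhs => rw [← chain_dirac_map_pad_shift (indepMH q w) x₀, imh_chain_shift_mode hw0 hmax 1]
  rw [Measure.map_add _ _ (measurable_pad x₀ 1), Measure.map_smul, Measure.map_smul, pow_one, sub_sub_cancel]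

/-! ## §3 The thaw decomposition to depth `n` -/

/-- **THE THAW DECOMPOSITION TO DEPTH `n`**:
`P_{x₀} = Σ_{t<n} A r^t·(pad_{t+1})_* P_π + r^n·(pad_n)_* P_{x₀}` for every `n`. [ours] -/
theorem imh_chain_thaw_depth [Fact (Measurable w)] (hw0 : ∀ y, 0 < w y) {x₀ : Ω} (hmax : ∀ y, w y ≤ w x₀)
    [IsProbabilityMeasure (q.withDensity fun y => ENNReal.ofReal (w y))] (n : ℕ) :
    Kernel.trajMeasure (X := fun _ : ℕ => Ω) (Measure.dirac x₀)
        (fun n : ℕ => (indepMH q w).comap (fun h : (i : ↥(Finset.Iic n)) → Ω => h ⟨n, Finset.mem_Iic.2 le_rfl⟩)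
          (measurable_pi_apply _)) =
      (∑ t ∈ Finset.range n, ENNReal.ofReal ((w x₀)⁻¹ * (1 - (w x₀)⁻¹) ^ t) •
          (Kernel.trajMeasure (X := fun _ : ℕ => Ω) (q.withDensity fun y => ENNReal.ofReal (w y))
            (fun n : ℕ => (indepMH q w).comap (fun h : (i : ↥(Finset.Iic n)) → Ω => h ⟨n, Finset.mem_Iic.2 le_rfl⟩)
              (measurable_pi_apply _))).map
            (fun (y : ℕ → Ω) (m : ℕ) => if m < t + 1 then x₀ else y (m - (t + 1)))) +
        ENNReal.ofReal ((1 - (w x₀)⁻¹) ^ n) •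
          (Kernel.trajMeasure (X := fun _ : ℕ => Ω) (Measure.dirac x₀)
            (fun n : ℕ => (indepMH q w).comap (fun h : (i : ↥(Finset.Iic n)) → Ω => h ⟨n, Finset.mem_Iic.2 le_rfl⟩)
              (measurable_pi_apply _))).map (fun (y : ℕ → Ω) (m : ℕ) => if m < n then x₀ else y (m - n)) := by
  have hA0 : 0 ≤ (w x₀)⁻¹ := inv_nonneg.mpr (hw0 x₀).le
  have hW : 1 ≤ w x₀ := one_le_of_mode (q := q) hmax
  have hr0 : 0 ≤ 1 - (w x₀)⁻¹ := sub_nonneg.2 (inv_le_one_of_one_le₀ hW)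
  induction n with
  | zero =>
    rw [Finset.sum_range_zero, zero_add, pow_zero, ENNReal.ofReal_one, one_smul, pad_zero, Measure.map_id]
  | succ n ih =>
    rw [Finset.sum_range_succ, add_assoc]
    conv_lhs => rw [ih]
    congr 1
    conv_lhs => rw [imh_chain_thaw_step hw0 hmax, Measure.map_add _ _ (measurable_pad x₀ n), Measure.map_smul,
      Measure.map_smul, map_pad_map_pad, map_pad_map_pad, smul_add, smul_smul, smul_smul,
      ← ENNReal.ofReal_mul (pow_nonneg hr0 n), ← ENNReal.ofReal_mul (pow_nonneg hr0 n)]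
    rw [show (1 - (w x₀)⁻¹) ^ n * (w x₀)⁻¹ = (w x₀)⁻¹ * (1 - (w x₀)⁻¹) ^ n by ring,
      show (1 - (w x₀)⁻¹) ^ n * (1 - (w x₀)⁻¹) = (1 - (w x₀)⁻¹) ^ (n + 1) by ring]

/-- **Integral form**: for every bounded measurable path statistic `F` and every `n`,
`E_{x₀}[F] = Σ_{t<n} A r^t·E_π[F ∘ pad_{t+1}] + r^n·E_{x₀}[F ∘ pad_n]`. [ours] -/
theorem imh_chain_thaw_integral [Fact (Measurable w)] (hw0 : ∀ y, 0 < w y) {x₀ : Ω} (hmax : ∀ y, w y ≤ w x₀)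
    [IsProbabilityMeasure (q.withDensity fun y => ENNReal.ofReal (w y))]
    {F : (ℕ → Ω) → ℝ} (hF : Measurable F) {C : ℝ} (hC : ∀ x, |F x| ≤ C) (n : ℕ) :
    ∫ x, F x ∂(Kernel.trajMeasure (X := fun _ : ℕ => Ω) (Measure.dirac x₀)
        (fun n : ℕ => (indepMH q w).comap (fun h : (i : ↥(Finset.Iic n)) → Ω => h ⟨n, Finset.mem_Iic.2 le_rfl⟩)
          (measurable_pi_apply _))) =
      (∑ t ∈ Finset.range n, (w x₀)⁻¹ * (1 - (w x₀)⁻¹) ^ t *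
          ∫ y, F (fun m => if m < t + 1 then x₀ else y (m - (t + 1)))
            ∂(Kernel.trajMeasure (X := fun _ : ℕ => Ω) (q.withDensity fun y => ENNReal.ofReal (w y))
              (fun n : ℕ => (indepMH q w).comap (fun h : (i : ↥(Finset.Iic n)) → Ω => h ⟨n, Finset.mem_Iic.2 le_rfl⟩)
                (measurable_pi_apply _)))) +
        (1 - (w x₀)⁻¹) ^ n *
          ∫ y, F (fun m => if m < n then x₀ else y (m - n))
            ∂(Kernel.trajMeasure (X := fun _ : ℕ => Ω) (Measure.dirac x₀)
              (fun n : ℕ => (indepMH q w).comap (fun h : (i : ↥(Finset.Iic n)) → Ω => h ⟨n, Finset.mem_Iic.2 le_rfl⟩)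
                (measurable_pi_apply _))) := by
  have hA0 : 0 ≤ (w x₀)⁻¹ := inv_nonneg.mpr (hw0 x₀).le
  have hW : 1 ≤ w x₀ := one_le_of_mode (q := q) hmax
  have hr0 : 0 ≤ 1 - (w x₀)⁻¹ := sub_nonneg.2 (inv_le_one_of_one_le₀ hW)
  set Pπ := Kernel.trajMeasure (X := fun _ : ℕ => Ω) (q.withDensity fun y => ENNReal.ofReal (w y))
      (fun n : ℕ => (indepMH q w).comap (fun h : (i : ↥(Finset.Iic n)) → Ω => h ⟨n, Finset.mem_Iic.2 le_rfl⟩)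
        (measurable_pi_apply _)) with hPπ
  set P0 := Kernel.trajMeasure (X := fun _ : ℕ => Ω) (Measure.dirac x₀)
      (fun n : ℕ => (indepMH q w).comap (fun h : (i : ↥(Finset.Iic n)) → Ω => h ⟨n, Finset.mem_Iic.2 le_rfl⟩)
        (measurable_pi_apply _)) with hP0
  have hdec := imh_chain_thaw_depth (q := q) hw0 hmax n (x₀ := x₀)
  rw [← hPπ, ← hP0] at hdec
  have hintF : ∀ (μ : Measure (ℕ → Ω)) [IsFiniteMeasure μ], Integrable F μ := fun μ _ =>
    integrable_of_bounded μ hF hC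
  conv_lhs => rw [hdec]
  rw [integral_add_measure, integral_finsetSum_measure, integral_smul_measure,
    integral_map (measurable_pad x₀ n).aemeasurable hF.aestronglyMeasurable,
    ENNReal.toReal_ofReal (pow_nonneg hr0 n), smul_eq_mul]
  · congr 1
    refine Finset.sum_congr rfl fun t _ => ?_
    rw [integral_smul_measure, integral_map (measurable_pad x₀ (t + 1)).aemeasurable hF.aestronglyMeasurable,
      ENNReal.toReal_ofReal (mul_nonneg hA0 (pow_nonneg hr0 t)), smul_eq_mul]
  · intro t _
    exact ((hintF _).smul_measure ENNReal.ofReal_ne_top)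
  · exact integrable_finsetSum_measure.2 fun t _ => (hintF _).smul_measure ENNReal.ofReal_ne_top
  · exact (hintF _).smul_measure ENNReal.ofReal_ne_top

/-- **THE EXACT LAW OF THE FIRST `n` CONFIGURATIONS**: for a bounded measurable statistic `F` of the first `n`
configurations only, `E_{x₀}[F] = Σ_{t<n} A r^t·E_π[F ∘ pad_{t+1}] + r^n·F(x₀, x₀, …)`. [ours] -/
theorem imh_chain_thaw_integral_of_dependsOn [Fact (Measurable w)] (hw0 : ∀ y, 0 < w y) {x₀ : Ω}
    (hmax : ∀ y, w y ≤ w x₀) [IsProbabilityMeasure (q.withDensity fun y => ENNReal.ofReal (w y))]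
    {F : (ℕ → Ω) → ℝ} (hF : Measurable F) {C : ℝ} (hC : ∀ x, |F x| ≤ C) {n : ℕ}
    (hdep : ∀ x y : ℕ → Ω, (∀ i, i < n → x i = y i) → F x = F y) :
    ∫ x, F x ∂(Kernel.trajMeasure (X := fun _ : ℕ => Ω) (Measure.dirac x₀)
        (fun n : ℕ => (indepMH q w).comap (fun h : (i : ↥(Finset.Iic n)) → Ω => h ⟨n, Finset.mem_Iic.2 le_rfl⟩)
          (measurable_pi_apply _))) =
      (∑ t ∈ Finset.range n, (w x₀)⁻¹ * (1 - (w x₀)⁻¹) ^ t *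
          ∫ y, F (fun m => if m < t + 1 then x₀ else y (m - (t + 1)))
            ∂(Kernel.trajMeasure (X := fun _ : ℕ => Ω) (q.withDensity fun y => ENNReal.ofReal (w y))
              (fun n : ℕ => (indepMH q w).comap (fun h : (i : ↥(Finset.Iic n)) → Ω => h ⟨n, Finset.mem_Iic.2 le_rfl⟩)
                (measurable_pi_apply _)))) +
        (1 - (w x₀)⁻¹) ^ n * F (fun _ => x₀) := by
  rw [imh_chain_thaw_integral hw0 hmax hF hC n]
  congr 2
  have hconst : (fun y : ℕ → Ω => F (fun m => if m < n then x₀ else y (m - n))) = fun _ => F (fun _ => x₀) := by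
    funext y
    exact hdep _ _ fun i hi => by rw [if_pos hi]
  rw [hconst, integral_const, probReal_univ, smul_eq_mul, one_mul]

/-! ## §4 The full thaw decomposition -/

/-- **THE THAW DECOMPOSITION** as an identity of measures on path space:
`P_{x₀} = Σ_{t≥0} A r^t·(pad_{t+1})_* P_π`. [ours] -/
theorem imh_chain_thaw_sum [Fact (Measurable w)] (hw0 : ∀ y, 0 < w y) {x₀ : Ω} (hmax : ∀ y, w y ≤ w x₀)
    [IsProbabilityMeasure (q.withDensity fun y => ENNReal.ofReal (w y))] :
    Kernel.trajMeasure (X := fun _ : ℕ => Ω) (Measure.dirac x₀)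
        (fun n : ℕ => (indepMH q w).comap (fun h : (i : ↥(Finset.Iic n)) → Ω => h ⟨n, Finset.mem_Iic.2 le_rfl⟩)
          (measurable_pi_apply _)) =
      Measure.sum (fun t : ℕ => ENNReal.ofReal ((w x₀)⁻¹ * (1 - (w x₀)⁻¹) ^ t) •
        (Kernel.trajMeasure (X := fun _ : ℕ => Ω) (q.withDensity fun y => ENNReal.ofReal (w y))
          (fun n : ℕ => (indepMH q w).comap (fun h : (i : ↥(Finset.Iic n)) → Ω => h ⟨n, Finset.mem_Iic.2 le_rfl⟩)
            (measurable_pi_apply _))).map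
          (fun (y : ℕ → Ω) (m : ℕ) => if m < t + 1 then x₀ else y (m - (t + 1)))) := by
  have hA0 : 0 < (w x₀)⁻¹ := inv_pos.mpr (hw0 x₀)
  have hW : 1 ≤ w x₀ := one_le_of_mode (q := q) hmax
  have hr0 : 0 ≤ 1 - (w x₀)⁻¹ := sub_nonneg.2 (inv_le_one_of_one_le₀ hW)
  have hr1 : 1 - (w x₀)⁻¹ < 1 := sub_lt_self _ hA0
  set Pπ := Kernel.trajMeasure (X := fun _ : ℕ => Ω) (q.withDensity fun y => ENNReal.ofReal (w y))
      (fun n : ℕ => (indepMH q w).comap (fun h : (i : ↥(Finset.Iic n)) → Ω => h ⟨n, Finset.mem_Iic.2 le_rfl⟩)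
        (measurable_pi_apply _)) with hPπ
  set P0 := Kernel.trajMeasure (X := fun _ : ℕ => Ω) (Measure.dirac x₀)
      (fun n : ℕ => (indepMH q w).comap (fun h : (i : ↥(Finset.Iic n)) → Ω => h ⟨n, Finset.mem_Iic.2 le_rfl⟩)
        (measurable_pi_apply _)) with hP0
  ext E hE
  rw [Measure.sum_apply _ hE]
  simp only [Measure.smul_apply, smul_eq_mul]
  -- partial sums from the depth-`n` decomposition
  have hpart : ∀ n, P0 E = (∑ t ∈ Finset.range n, ENNReal.ofReal ((w x₀)⁻¹ * (1 - (w x₀)⁻¹) ^ t) *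
      (Pπ.map (fun (y : ℕ → Ω) (m : ℕ) => if m < t + 1 then x₀ else y (m - (t + 1)))) E) +
      ENNReal.ofReal ((1 - (w x₀)⁻¹) ^ n) *
        (P0.map (fun (y : ℕ → Ω) (m : ℕ) => if m < n then x₀ else y (m - n))) E := by
    intro n
    have hdec := imh_chain_thaw_depth (q := q) hw0 hmax n (x₀ := x₀)
    rw [← hPπ, ← hP0] at hdec
    conv_lhs => rw [hdec]
    rw [Measure.add_apply, Measure.finsetSum_apply]
    simp only [Measure.smul_apply, smul_eq_mul]
  refine le_antisymm ?_ ?_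
  · -- `P0 E ≤ partial_n + r^n`, and the right side tends to the series
    have hle : ∀ n, P0 E ≤ (∑ t ∈ Finset.range n, ENNReal.ofReal ((w x₀)⁻¹ * (1 - (w x₀)⁻¹) ^ t) *
        (Pπ.map (fun (y : ℕ → Ω) (m : ℕ) => if m < t + 1 then x₀ else y (m - (t + 1)))) E) +
        ENNReal.ofReal ((1 - (w x₀)⁻¹) ^ n) := by
      intro n
      rw [hpart n]
      gcongr
      haveI : IsProbabilityMeasure (P0.map (fun (y : ℕ → Ω) (m : ℕ) => if m < n then x₀ else y (m - n))) :=
        Measure.isProbabilityMeasure_map (measurable_pad x₀ n).aemeasurable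
      calc ENNReal.ofReal ((1 - (w x₀)⁻¹) ^ n) *
            (P0.map (fun (y : ℕ → Ω) (m : ℕ) => if m < n then x₀ else y (m - n))) E
          ≤ ENNReal.ofReal ((1 - (w x₀)⁻¹) ^ n) * 1 := by gcongr; exact prob_le_one
        _ = _ := mul_one _
    have hlim : Tendsto (fun n => (∑ t ∈ Finset.range n, ENNReal.ofReal ((w x₀)⁻¹ * (1 - (w x₀)⁻¹) ^ t) *
        (Pπ.map (fun (y : ℕ → Ω) (m : ℕ) => if m < t + 1 then x₀ else y (m - (t + 1)))) E) +
        ENNReal.ofReal ((1 - (w x₀)⁻¹) ^ n)) atTop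
        (𝓝 ((∑' t, ENNReal.ofReal ((w x₀)⁻¹ * (1 - (w x₀)⁻¹) ^ t) *
          (Pπ.map (fun (y : ℕ → Ω) (m : ℕ) => if m < t + 1 then x₀ else y (m - (t + 1)))) E) + 0)) := by
      refine Tendsto.add (ENNReal.tendsto_nat_tsum _) ?_
      rw [← ENNReal.ofReal_zero]
      exact ENNReal.tendsto_ofReal (tendsto_pow_atTop_nhds_zero_of_lt_one hr0 hr1)
    rw [add_zero] at hlim
    exact ge_of_tendsto' hlim hle
  · -- every partial sum is below `P0 E`
    rw [ENNReal.tsum_eq_iSup_nat]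
    refine iSup_le fun n => ?_
    rw [hpart n]
    exact le_self_add

/-- **Integral form of the thaw decomposition**: `E_{x₀}[F] = Σ_{t≥0} A r^t·E_π[F ∘ pad_{t+1}]` for every bounded
measurable path statistic `F`. [ours] -/
theorem imh_chain_thaw_hasSum [Fact (Measurable w)] (hw0 : ∀ y, 0 < w y) {x₀ : Ω} (hmax : ∀ y, w y ≤ w x₀)
    [IsProbabilityMeasure (q.withDensity fun y => ENNReal.ofReal (w y))]
    {F : (ℕ → Ω) → ℝ} (hF : Measurable F) {C : ℝ} (hC : ∀ x, |F x| ≤ C) :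
    HasSum (fun t : ℕ => (w x₀)⁻¹ * (1 - (w x₀)⁻¹) ^ t *
        ∫ y, F (fun m => if m < t + 1 then x₀ else y (m - (t + 1)))
          ∂(Kernel.trajMeasure (X := fun _ : ℕ => Ω) (q.withDensity fun y => ENNReal.ofReal (w y))
            (fun n : ℕ => (indepMH q w).comap (fun h : (i : ↥(Finset.Iic n)) → Ω => h ⟨n, Finset.mem_Iic.2 le_rfl⟩)
              (measurable_pi_apply _))))
      (∫ x, F x ∂(Kernel.trajMeasure (X := fun _ : ℕ => Ω) (Measure.dirac x₀)
        (fun n : ℕ => (indepMH q w).comap (fun h : (i : ↥(Finset.Iic n)) → Ω => h ⟨n, Finset.mem_Iic.2 le_rfl⟩)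
          (measurable_pi_apply _)))) := by
  have hA0 : 0 < (w x₀)⁻¹ := inv_pos.mpr (hw0 x₀)
  have hW : 1 ≤ w x₀ := one_le_of_mode (q := q) hmax
  have hr0 : 0 ≤ 1 - (w x₀)⁻¹ := sub_nonneg.2 (inv_le_one_of_one_le₀ hW)
  have hr1 : 1 - (w x₀)⁻¹ < 1 := sub_lt_self _ hA0
  set Pπ := Kernel.trajMeasure (X := fun _ : ℕ => Ω) (q.withDensity fun y => ENNReal.ofReal (w y))
      (fun n : ℕ => (indepMH q w).comap (fun h : (i : ↥(Finset.Iic n)) → Ω => h ⟨n, Finset.mem_Iic.2 le_rfl⟩)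
        (measurable_pi_apply _)) with hPπ
  set P0 := Kernel.trajMeasure (X := fun _ : ℕ => Ω) (Measure.dirac x₀)
      (fun n : ℕ => (indepMH q w).comap (fun h : (i : ↥(Finset.Iic n)) → Ω => h ⟨n, Finset.mem_Iic.2 le_rfl⟩)
        (measurable_pi_apply _)) with hP0
  -- the remainder `r^n·E_{x₀}[F ∘ pad_n]` tends to zero, so the partial sums tend to `E_{x₀}[F]`
  rw [hasSum_iff_tendsto_nat_of_summable_norm]
  · have hrem : Tendsto (fun n : ℕ => (1 - (w x₀)⁻¹) ^ n *
        ∫ y, F (fun m => if m < n then x₀ else y (m - n)) ∂P0) atTop (𝓝 0) := by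
      have hg : Tendsto (fun n : ℕ => (1 - (w x₀)⁻¹) ^ n * C) atTop (𝓝 0) := by
        simpa using (tendsto_pow_atTop_nhds_zero_of_lt_one hr0 hr1).mul_const C
      refine squeeze_zero_norm (fun n => ?_) hg
      rw [Real.norm_eq_abs, abs_mul, abs_of_nonneg (pow_nonneg hr0 n)]
      exact mul_le_mul_of_nonneg_left (abs_integral_path_le P0 (F := fun y =>
        F (fun m => if m < n then x₀ else y (m - n))) fun y => hC _) (pow_nonneg hr0 n)
    have heq : ∀ n, ∑ t ∈ Finset.range n, (w x₀)⁻¹ * (1 - (w x₀)⁻¹) ^ t *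
        ∫ y, F (fun m => if m < t + 1 then x₀ else y (m - (t + 1))) ∂Pπ =
        ∫ x, F x ∂P0 - (1 - (w x₀)⁻¹) ^ n * ∫ y, F (fun m => if m < n then x₀ else y (m - n)) ∂P0 := by
      intro n
      have h := imh_chain_thaw_integral (q := q) hw0 hmax hF hC n (x₀ := x₀)
      rw [← hPπ, ← hP0] at h
      linarith
    simp_rw [heq]
    have := (tendsto_const_nhds (x := ∫ x, F x ∂P0)).sub hrem
    rwa [sub_zero] at this
  · refine Summable.of_nonneg_of_le (fun t => norm_nonneg _) (fun t => ?_)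
      ((summable_geometric_of_lt_one hr0 hr1).mul_left ((w x₀)⁻¹ * C))
    rw [Real.norm_eq_abs, abs_mul, abs_mul, abs_of_nonneg hA0.le, abs_of_nonneg (pow_nonneg hr0 t)]
    calc (w x₀)⁻¹ * (1 - (w x₀)⁻¹) ^ t * |∫ y, F (fun m => if m < t + 1 then x₀ else y (m - (t + 1))) ∂Pπ|
        ≤ (w x₀)⁻¹ * (1 - (w x₀)⁻¹) ^ t * C :=
          mul_le_mul_of_nonneg_left (abs_integral_path_le Pπ (F := fun y =>
            F (fun m => if m < t + 1 then x₀ else y (m - (t + 1)))) fun y => hC _)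
            (mul_nonneg hA0.le (pow_nonneg hr0 t))
      _ = (w x₀)⁻¹ * C * (1 - (w x₀)⁻¹) ^ t := by ring

end Summit.Ventures.LatticeQCDFlow.Exactness
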